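import Summits.QuantumFields.BalabanUV.Beta.GAN24.GaugeReadCharge
import Summits.QuantumFields.BalabanUV.Beta.GAN24.GaugeReadChargeDipole

/-!
# `BalabanUV.Beta.GAN24.GaugeReadChargeProfile` — binder row G-an2-4 ∕ (CONV-C), CT-W «WC-TL», (Q-R) «QR-LL», the (S) row of RULING R-gan24p1-g27-1
# (the OWNER gan24-p1 g27's R14: (S)_j = (INV)_j ∧ W-Z0 ⇒ (M0) ∧ (Π) by `SlotMomentParity`), piece (γ) = the response (gauge-read) letter:
# **THE (γ) SLOT-CHARGE PROFILE IN THE PARITY CURRENCY — ITS ω-CHARGE PER SLOT (value), ITS EXPONENTIAL ENVELOPE ABOUT THE LABEL (the `hZb` socket), ITS MASS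
# AND FIRST SLOT-MOMENT AS `HasSum`S (the `hm` ∕ `hμ` sockets)** — for ANY bounded two-leg weight `ω`, the plain pair charge being `ω ≡ 1`
# (G-an2-4 formalisation swarm, unit `b2b-balaban-gan24-formalise-leaf-06`, gen 45; INTENT 1, sequel of `GaugeReadCharge` (INTENT 3 g44) and `GaugeReadChargeDipole` (INTENT 4 g44)).

NOT IN PRINT; OUR BOOKKEEPING ([folklore]: a bounded two-leg weight is ABSORBED INTO THE TABLES (`S ↦ ω•S`, `M ↦ ω•M` stay `LocStencil` ∕ `VertexFamily` with constants
`B·Cs` ∕ `B·CM`), so the gen-44 theorems `GaugeReadCharge.hasSum_prod_gaugeSup` and `GaugeReadChargeDipole.hasSum_slotMoment_gaugeCharge` apply BY NAME; one envelope from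
`GaugeReadChargeDipole.abs_read_gaugeWt_le ∕ abs_tsum_prod_le_of_biLoc`; one Fubini per stencil index on `GaugeReadChargeDipole.summable_shifted_majorant`).  HONEST FRAMING
(cell contract, verbatim): «discharging `BetaPertH` makes Bałaban's UV stability UNCONDITIONAL — a real constructive-QFT result; it is NOT the continuum limit and NOT the Clay
problem.»  HONEST DEPENDENCY (verbatim): «continuum YM on T⁴ ⇐ BetaPertH ∧ nine spine estimates (0/9 proved); BetaPertH ⇐ (D1) ∧ (D4) ∧ CAP+tail; G-an2-4 gates asym, D1 and
NE2/3/4.»  No cited fact, no `def`, no `def … : Prop`, 0 sorry.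

SETTING (that of `GaugeReadChargeDipole.hasSum_slotMoment_gaugeCharge`): `1 ≤ N`; the response kernels `A ν y′` of the multiplier slots `(ν, y′)` form a `VertexFamily A N CA δ`;
`S` a localised stencil table (`LocStencil S Cs δ`), `M` a vertex table (`VertexFamily M N CM δ`), rate `δ > 0`; label `y`; channel `(a, b)`; a two-leg weight
`ω : Site × Site → ℝ` with `|ω| ≤ B`.  The ω-CHARGE of a kernel `K` is `Z_ω(K) := Σ'_{(x,z)} ω(x,z)·K x z a b` (road-P2's currency, `WardResidualRotatedVertexWeighted`); the
read weights are `w_κ(y′,u) := Σ'_{x₂} Σ_κ₂ A ν y′ u x₂ (inl κ)(inl κ₂)·gaugeWt N y κ₂ x₂` (fine) and `w′_ρ(y′,w) :=` the same at `u = N•w`, row `inr ρ` (coarse); the (γ)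
ω-CHARGE AT THE SLOT `(ν, y′)` is `Q_ω(y′) := Σ_κ Σ'_u w_κ(y′,u)·Z_ω(S κ u) + Σ_ρ Σ'_w w′_ρ(y′,w)·Z_ω(M ρ w)` — all written out below, no `def`.
* §1 ABSORPTION (`biLoc ∕ locStencil ∕ vertexFamily_weightMul`, `wsum ∕ cwsum ∕ gaugeSup_weightMul_apply`); §2 **`hasSum_weighted_gaugeSup`** (the ω-charge of the (γ) piece IS
  `Q_ω(y′)`; `ω ≡ 1` is INTENT 3) and **`hasSum_slotMoment_weightedGaugeCharge`** (INTENT 4 §5 in the ω-currency — the `hμ` socket of `SlotMomentParity.hasSum_moments_sum`).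
* §3 THE ENVELOPE — **`abs_weightedGaugeCharge_le`**: `|Q_ω(y′)| ≤ B_γ · e^{−(δ∕2)·‖y′ − y‖₁}` for EVERY slot `y′`, `B_γ = (d+1)·K₁·(B·(Cs + CM))·Zl(δ)³`,
  `K₁ = (d+1)·CA·Zl(δ∕2)·e^{(δ∕2)((d+1)N+1)}` — the VERBATIM `hZb` socket of `SlotMomentParity.tsum_slotMoment_eq_zero_of_slotInv ∕ moments_of_slotInv` (rate `δ∕2`).
* §4 THE MASS — **`hasSum_weightedGaugeCharge_mass`**: `HasSum (y′ ↦ Q_ω(y′)) (Σ_κ Σ'_u (Σ'_{y′} w_κ(y′,u))·Z_ω(S κ u) + Σ_ρ Σ'_w (Σ'_{y′} w′_ρ(y′,w))·Z_ω(M ρ w))` — the `hm`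
  socket; value = pair charges × SLOT-SUMMED read weights (whether it is `0` is (M0)_γ, NOT claimed); §5 PLAIN CURRENCY (`ω ≡ 1`): `abs_gaugeCharge_le`, `hasSum_gaugeCharge_mass`.
Asserts NO value of any pair charge, NO (M0)_γ, NO (Π), NOTHING of (INV); 0 estimate uniform in the level (`K₁` carries `e^{(δ∕2)((d+1)N+1)}` by design, displayed);
discharges NOTHING of (S) ∕ (Q-R) ∕ (LT) ∕ (Q-L) ∕ (C) ∕ «T2Shape» ∕ «T2Drift» ∕ (hW, hWall); NEVER «G-an2-4 closed» as (CONV-C); NOT D1, NOT BetaPertH, NOT continuum, NOT Clay.  2026-08-22.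
-/

noncomputable section

open Finset
open scoped BigOperators
open Literature.MathematicalPhysics.QuantumFieldTheory
open Literature.MathematicalPhysics.QuantumFieldTheory.Balaban1983to89
open Literature.MathematicalPhysics.QuantumFieldTheory.Balaban1983to89.Beta
open B12Sec2to5 (l1 l1_nonneg)
open ExpKernelCalculus (Site MKer BiLoc VertexFamily Zl Zl_nonneg Zl_pos summable_exp_shift' tsum_exp_shift' l1_sub_symm l1_natSmul)
open OneStepResolventKernel (Fib wsum LocStencil)
open InterLevelTransport (cwsum cwsum_apply)
open Summit.QuantumFields.BalabanUV.Beta.KernelWardRelative (gaugeWt)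
open Summit.QuantumFields.BalabanUV.Beta.GAN24.GaugeReadCharge (hasSum_prod_gaugeSup)
open Summit.QuantumFields.BalabanUV.Beta.GAN24.GaugeReadChargeDipole (abs_read_gaugeWt_le abs_tsum_prod_le_of_biLoc summable_shifted_majorant
  hasSum_slotMoment_gaugeCharge)

namespace Summit.QuantumFields.BalabanUV.Beta.GAN24.GaugeReadChargeProfile

variable {d : ℕ}

/-! ## §1 Absorbing a bounded two-leg weight into the tables -/

/-- [folklore] A kernel bi-localised at `(p, q)` with constant `C`, multiplied pointwise by a two-leg weight `|ω| ≤ B`, is bi-localised there with constant `B·C`. -/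
theorem biLoc_weightMul {K : MKer (d + 1) (Fib d)} {p q : Site (d + 1)} {C δ : ℝ} (hK : BiLoc K p q C δ)
    {ω : Site (d + 1) × Site (d + 1) → ℝ} {B : ℝ} (hω : ∀ xz, |ω xz| ≤ B) :
    BiLoc (fun x z a b => ω (x, z) * K x z a b) p q (B * C) δ := by
  intro x z a b
  show |ω (x, z) * K x z a b| ≤ B * C * Real.exp (-δ * (l1 (x - p) + l1 (z - q)))
  rw [abs_mul, mul_assoc]
  exact mul_le_mul (hω (x, z)) (hK x z a b) (abs_nonneg _) ((abs_nonneg _).trans (hω (x, z)))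

/-- [folklore] ABSORPTION INTO A STENCIL TABLE: `LocStencil S Cs δ`, `|ω| ≤ B` ⇒ `LocStencil (ω•S) (B·Cs) δ`. -/
theorem locStencil_weightMul {S : Fin (d + 1) → Site (d + 1) → MKer (d + 1) (Fib d)} {Cs δ : ℝ} (hS : LocStencil S Cs δ)
    {ω : Site (d + 1) × Site (d + 1) → ℝ} {B : ℝ} (hω : ∀ xz, |ω xz| ≤ B) :
    LocStencil (fun κ u => fun x z a b => ω (x, z) * S κ u x z a b) (B * Cs) δ :=
  fun κ u => biLoc_weightMul (hS κ u) hω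

/-- [folklore] ABSORPTION INTO A VERTEX TABLE: `VertexFamily M N CM δ`, `|ω| ≤ B` ⇒ `VertexFamily (ω•M) N (B·CM) δ`. -/
theorem vertexFamily_weightMul {N : ℕ} {M : Fin (d + 1) → Site (d + 1) → MKer (d + 1) (Fib d)} {CM δ : ℝ} (hM : VertexFamily M N CM δ)
    {ω : Site (d + 1) × Site (d + 1) → ℝ} {B : ℝ} (hω : ∀ xz, |ω xz| ≤ B) :
    VertexFamily (fun ρ w => fun x z a b => ω (x, z) * M ρ w x z a b) N (B * CM) δ :=
  fun ρ w => biLoc_weightMul (hM ρ w) hω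

/-- [folklore] `wsum` is linear in the table, pointwise: `wsum w (ω•S) x z a b = ω(x,z)·wsum w S x z a b`. -/
theorem wsum_weightMul_apply (w : Site (d + 1) → ℝ) (S : Site (d + 1) → MKer (d + 1) (Fib d)) (ω : Site (d + 1) × Site (d + 1) → ℝ)
    (x z : Site (d + 1)) (a b : Fib d) :
    wsum w (fun u => fun x z a b => ω (x, z) * S u x z a b) x z a b = ω (x, z) * wsum w S x z a b := by
  simp only [wsum]
  rw [← tsum_mul_left]
  exact tsum_congr fun u => by ring

/-- [folklore] `cwsum` is linear in the table, pointwise: `cwsum N w (ω•M) x z a b = ω(x,z)·cwsum N w M x z a b`. -/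
theorem cwsum_weightMul_apply {N : ℕ} [NeZero N] (w : Site (d + 1) → ℝ) (M : Site (d + 1) → MKer (d + 1) (Fib d))
    (ω : Site (d + 1) × Site (d + 1) → ℝ) (x z : Site (d + 1)) (a b : Fib d) :
    cwsum N w (fun y => fun x z a b => ω (x, z) * M y x z a b) x z a b = ω (x, z) * cwsum N w M x z a b := by
  rw [cwsum_apply, cwsum_apply, ← tsum_mul_left]
  exact tsum_congr fun y => by ring

/-- [folklore] **THE RESPONSE PIECE BUILT ON THE ABSORBED TABLES IS `ω ·` THE RESPONSE PIECE**, pointwise: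
`(Σ_κ wsum w_κ (ω•S κ) + Σ_ρ cwsum N w′_ρ (ω•M ρ)) x z a b = ω(x,z)·(Σ_κ wsum w_κ (S κ) + Σ_ρ cwsum N w′_ρ (M ρ)) x z a b`. -/
theorem gaugeSup_weightMul_apply {N : ℕ} [NeZero N] (wF wC : Fin (d + 1) → Site (d + 1) → ℝ)
    (S M : Fin (d + 1) → Site (d + 1) → MKer (d + 1) (Fib d)) (ω : Site (d + 1) × Site (d + 1) → ℝ) (x z : Site (d + 1)) (a b : Fib d) :
    (∑ κ, wsum (wF κ) (fun u => fun x z a b => ω (x, z) * S κ u x z a b)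
        + ∑ ρ, cwsum N (wC ρ) (fun y => fun x z a b => ω (x, z) * M ρ y x z a b)) x z a b
      = ω (x, z) * (∑ κ, wsum (wF κ) (S κ) + ∑ ρ, cwsum N (wC ρ) (M ρ)) x z a b := by
  simp only [Pi.add_apply, Finset.sum_apply, wsum_weightMul_apply, cwsum_weightMul_apply, mul_add, Finset.mul_sum]

/-! ## §2 The ω-charge of the (γ) piece per slot, and its first slot-moment, BY NAME from INTENT 3 ∕ 4 at the absorbed tables -/

/-- NOT IN PRINT; OUR BOOKKEEPING.  **THE ω-CHARGE OF THE RESPONSE PIECE** (`A` bi-localised at `(p, q)`, rate `δ > 0`; `|g κ x| ≤ 1`; `LocStencil S Cs δ`,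
`VertexFamily M N CM δ`, `1 ≤ N`; `|ω| ≤ B`): `Σ'_{(x,z)} ω(x,z)·𝒢[A](g)(x,z)(a,b) = Σ_κ Σ'_u w_κ(u)·Z_ω(S κ u) + Σ_ρ Σ'_y w′_ρ(y)·Z_ω(M ρ y)`,
`Z_ω(K) = Σ'_{(x,z)} ω(x,z)·K x z a b` — `GaugeReadCharge.hasSum_prod_gaugeSup` at the absorbed tables `ω•S`, `ω•M` (`ω ≡ 1` is that theorem).  With `A := A ν y′`,
`g := gaugeWt N y` the value is the (γ) ω-charge `Q_ω(y′)` of the slot `(ν, y′)`.  Nothing here makes any `Z_ω` vanish. -/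
theorem hasSum_weighted_gaugeSup {A : MKer (d + 1) (Fib d)} {p q : Site (d + 1)} {C δ : ℝ} (hA : BiLoc A p q C δ) (hδ : 0 < δ)
    {g : Fin (d + 1) → Site (d + 1) → ℝ} (hg : ∀ κ x, |g κ x| ≤ 1) {N : ℕ} [NeZero N] (hN : 1 ≤ N)
    {S : Fin (d + 1) → Site (d + 1) → MKer (d + 1) (Fib d)} {Cs : ℝ} (hS : LocStencil S Cs δ)
    {M : Fin (d + 1) → Site (d + 1) → MKer (d + 1) (Fib d)} {CM : ℝ} (hM : VertexFamily M N CM δ) (a b : Fib d)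
    {ω : Site (d + 1) × Site (d + 1) → ℝ} {B : ℝ} (hω : ∀ xz, |ω xz| ≤ B) :
    HasSum (fun xz : Site (d + 1) × Site (d + 1) => ω xz *
        (∑ κ, wsum (fun u => ∑' x₂, ∑ κ₂, A u x₂ (Sum.inl κ) (Sum.inl κ₂) * g κ₂ x₂) (S κ)
          + ∑ ρ, cwsum N (fun y => ∑' x₂, ∑ κ₂, A ((N : ℤ) • y) x₂ (Sum.inr ρ) (Sum.inl κ₂) * g κ₂ x₂) (M ρ)) xz.1 xz.2 a b)
      (∑ κ, ∑' u, (∑' x₂, ∑ κ₂, A u x₂ (Sum.inl κ) (Sum.inl κ₂) * g κ₂ x₂) *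
            ∑' xz : Site (d + 1) × Site (d + 1), ω xz * S κ u xz.1 xz.2 a b
        + ∑ ρ, ∑' y, (∑' x₂, ∑ κ₂, A ((N : ℤ) • y) x₂ (Sum.inr ρ) (Sum.inl κ₂) * g κ₂ x₂) *
            ∑' xz : Site (d + 1) × Site (d + 1), ω xz * M ρ y xz.1 xz.2 a b) := by
  have h := hasSum_prod_gaugeSup hA hδ hg hN (locStencil_weightMul hS hω) (vertexFamily_weightMul hM hω) a b
  refine h.congr_fun fun xz => ?_
  rw [gaugeSup_weightMul_apply]

/-- NOT IN PRINT; OUR BOOKKEEPING.  **THE FIRST SLOT-MOMENT OF THE (γ) ω-CHARGE IN CLOSED FORM** (`GaugeReadChargeDipole.hasSum_slotMoment_gaugeCharge` at the absorbed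
tables; the `hμ` socket of `SlotMomentParity.hasSum_moments_sum` for the (γ) piece, moment weight `(((y′ − y) lam : ℤ) : ℝ)` verbatim):
`Σ'_{y′} (y′ − y)_λ·Q_ω(y′) = Σ_κ Σ'_u (Σ'_{y′} (y′ − y)_λ·w_κ(y′,u))·Z_ω(S κ u) + Σ_ρ Σ'_w (Σ'_{y′} (y′ − y)_λ·w′_ρ(y′,w))·Z_ω(M ρ w)`.  Asserts NO value, NO cancellation. -/
theorem hasSum_slotMoment_weightedGaugeCharge {N : ℕ} (hN : 1 ≤ N) {A : Fin (d + 1) → Site (d + 1) → MKer (d + 1) (Fib d)} {CA δ : ℝ}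
    (hA : VertexFamily A N CA δ) (hδ : 0 < δ)
    {S : Fin (d + 1) → Site (d + 1) → MKer (d + 1) (Fib d)} {Cs : ℝ} (hS : LocStencil S Cs δ)
    {M : Fin (d + 1) → Site (d + 1) → MKer (d + 1) (Fib d)} {CM : ℝ} (hM : VertexFamily M N CM δ)
    (y : Site (d + 1)) (ν lam : Fin (d + 1)) (a b : Fib d) {ω : Site (d + 1) × Site (d + 1) → ℝ} {B : ℝ} (hω : ∀ xz, |ω xz| ≤ B) :
    HasSum (fun y' : Site (d + 1) => (((y' - y) lam : ℤ) : ℝ) *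
        (∑ κ, ∑' u, (∑' x₂, ∑ κ₂, A ν y' u x₂ (Sum.inl κ) (Sum.inl κ₂) * gaugeWt N y κ₂ x₂) *
              ∑' xz : Site (d + 1) × Site (d + 1), ω xz * S κ u xz.1 xz.2 a b
          + ∑ ρ, ∑' w, (∑' x₂, ∑ κ₂, A ν y' ((N : ℤ) • w) x₂ (Sum.inr ρ) (Sum.inl κ₂) * gaugeWt N y κ₂ x₂) *
              ∑' xz : Site (d + 1) × Site (d + 1), ω xz * M ρ w xz.1 xz.2 a b))
      (∑ κ, ∑' u, (∑' y' : Site (d + 1), (((y' - y) lam : ℤ) : ℝ) * ∑' x₂, ∑ κ₂, A ν y' u x₂ (Sum.inl κ) (Sum.inl κ₂) * gaugeWt N y κ₂ x₂) *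
            ∑' xz : Site (d + 1) × Site (d + 1), ω xz * S κ u xz.1 xz.2 a b
        + ∑ ρ, ∑' w, (∑' y' : Site (d + 1), (((y' - y) lam : ℤ) : ℝ) * ∑' x₂, ∑ κ₂, A ν y' ((N : ℤ) • w) x₂ (Sum.inr ρ) (Sum.inl κ₂) * gaugeWt N y κ₂ x₂) *
            ∑' xz : Site (d + 1) × Site (d + 1), ω xz * M ρ w xz.1 xz.2 a b) :=
  hasSum_slotMoment_gaugeCharge hN hA hδ (locStencil_weightMul hS hω) (vertexFamily_weightMul hM hω) y ν lam a b

/-! ## §3 The envelope: the (γ) ω-charge profile is exponentially localised at its label (the `hZb` socket) -/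

/-- [folklore] The coarse Gaussian is dominated by the fine one: `e^{−δ‖N•w − N•y′‖₁} ≤ e^{−δ‖w − y′‖₁}` for `1 ≤ N`, `0 ≤ δ`. -/
theorem exp_coarse_le {N : ℕ} (hN : 1 ≤ N) {δ : ℝ} (hδ : 0 ≤ δ) (w y' : Site (d + 1)) :
    Real.exp (-δ * l1 ((N : ℤ) • w - (N : ℤ) • y')) ≤ Real.exp (-δ * l1 (w - y')) := by
  rw [Real.exp_le_exp, ← smul_sub, l1_natSmul]
  have h4 := mul_le_mul_of_nonneg_left (le_mul_of_one_le_left (l1_nonneg (w - y')) (show (1 : ℝ) ≤ N by exact_mod_cast hN)) hδ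
  linarith

/-- [folklore] The slot Gaussian in the `hZb` shape: `e^{−(δ∕2)·N·‖y − y′‖₁} ≤ e^{−(δ∕2)·‖y′ − y‖₁}` for `1 ≤ N`, `0 ≤ δ`. -/
theorem exp_slot_le {N : ℕ} (hN : 1 ≤ N) {δ : ℝ} (hδ : 0 ≤ δ) (y y' : Site (d + 1)) :
    Real.exp (-(δ / 2) * ((N : ℝ) * l1 (y - y'))) ≤ Real.exp (-(δ / 2) * l1 (y' - y)) := by
  rw [Real.exp_le_exp, l1_sub_symm y y']
  have h4 := mul_le_mul_of_nonneg_left (le_mul_of_one_le_left (l1_nonneg (y' - y)) (show (1 : ℝ) ≤ N by exact_mod_cast hN)) (div_nonneg hδ zero_le_two)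
  linarith

/-- [folklore] **ONE FINE STENCIL INDEX**: the read weight times the ω-charge of the stencil is dominated, uniformly in the slot, by
`K₁·(B·Cs·Zl(δ)²)·e^{−(δ∕2)·N·‖y − y′‖₁}·e^{−δ‖u − N•y′‖₁}` (`K₁ = (d+1)·CA·Zl(δ∕2)·e^{(δ∕2)((d+1)N+1)}`). -/
theorem abs_fineTerm_le {N : ℕ} (hN : 1 ≤ N) {A' : MKer (d + 1) (Fib d)} {CA δ : ℝ} {y y' : Site (d + 1)}
    (hA : BiLoc A' ((N : ℤ) • y') ((N : ℤ) • y') CA δ) (hδ : 0 < δ)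
    {S : Fin (d + 1) → Site (d + 1) → MKer (d + 1) (Fib d)} {Cs : ℝ} (hS : LocStencil S Cs δ)
    {ω : Site (d + 1) × Site (d + 1) → ℝ} {B : ℝ} (hω : ∀ xz, |ω xz| ≤ B) (κ : Fin (d + 1)) (u : Site (d + 1)) (a' a b : Fib d) :
    |(∑' x₂, ∑ κ₂, A' u x₂ a' (Sum.inl κ₂) * gaugeWt N y κ₂ x₂) * ∑' xz : Site (d + 1) × Site (d + 1), ω xz * S κ u xz.1 xz.2 a b|
      ≤ ((d + 1 : ℕ) * CA * Zl (d + 1) (δ / 2) * Real.exp ((δ / 2) * (((d : ℝ) + 1) * N + 1))) * (B * Cs * (Zl (d + 1) δ * Zl (d + 1) δ))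
          * Real.exp (-(δ / 2) * ((N : ℝ) * l1 (y - y'))) * Real.exp (-δ * l1 (u - (N : ℤ) • y')) := by
  have hw := abs_read_gaugeWt_le hN (y := y) hA hδ u a'
  have hZ := abs_tsum_prod_le_of_biLoc (biLoc_weightMul (hS κ u) hω) hδ a b
  rw [abs_mul]
  calc |∑' x₂, ∑ κ₂, A' u x₂ a' (Sum.inl κ₂) * gaugeWt N y κ₂ x₂| * |∑' xz : Site (d + 1) × Site (d + 1), ω xz * S κ u xz.1 xz.2 a b|
      ≤ (((d + 1 : ℕ) * CA * Zl (d + 1) (δ / 2) * Real.exp ((δ / 2) * (((d : ℝ) + 1) * N + 1))) *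
          Real.exp (-(δ / 2) * ((N : ℝ) * l1 (y - y'))) * Real.exp (-δ * l1 (u - (N : ℤ) • y'))) * (B * Cs * (Zl (d + 1) δ * Zl (d + 1) δ)) :=
        mul_le_mul hw hZ (abs_nonneg _) ((abs_nonneg _).trans hw)
    _ = _ := by ring

/-- [folklore] **ONE COARSE STENCIL INDEX**: the coarse read weight times the ω-charge of the vertex table is dominated by
`K₁·(B·CM·Zl(δ)²)·e^{−(δ∕2)·N·‖y − y′‖₁}·e^{−δ‖w − y′‖₁}`. -/
theorem abs_coarseTerm_le {N : ℕ} (hN : 1 ≤ N) {A' : MKer (d + 1) (Fib d)} {CA δ : ℝ} {y y' : Site (d + 1)}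
    (hA : BiLoc A' ((N : ℤ) • y') ((N : ℤ) • y') CA δ) (hδ : 0 < δ)
    {M : Fin (d + 1) → Site (d + 1) → MKer (d + 1) (Fib d)} {CM : ℝ} (hM : VertexFamily M N CM δ)
    {ω : Site (d + 1) × Site (d + 1) → ℝ} {B : ℝ} (hω : ∀ xz, |ω xz| ≤ B) (ρ : Fin (d + 1)) (w : Site (d + 1)) (a' a b : Fib d) :
    |(∑' x₂, ∑ κ₂, A' ((N : ℤ) • w) x₂ a' (Sum.inl κ₂) * gaugeWt N y κ₂ x₂) * ∑' xz : Site (d + 1) × Site (d + 1), ω xz * M ρ w xz.1 xz.2 a b|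
      ≤ ((d + 1 : ℕ) * CA * Zl (d + 1) (δ / 2) * Real.exp ((δ / 2) * (((d : ℝ) + 1) * N + 1))) * (B * CM * (Zl (d + 1) δ * Zl (d + 1) δ))
          * Real.exp (-(δ / 2) * ((N : ℝ) * l1 (y - y'))) * Real.exp (-δ * l1 (w - y')) := by
  have hw := abs_read_gaugeWt_le hN (y := y) hA hδ ((N : ℤ) • w) a'
  have hZ := abs_tsum_prod_le_of_biLoc (biLoc_weightMul (hM ρ w) hω) hδ a b
  have hexp := exp_coarse_le (d := d) hN hδ.le w y'
  have hK0 : 0 ≤ (d + 1 : ℕ) * CA * Zl (d + 1) (δ / 2) * Real.exp ((δ / 2) * (((d : ℝ) + 1) * N + 1)) := by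
    have hC : 0 ≤ CA := hA.nonneg a'; have := Zl_nonneg (D := d + 1) (half_pos hδ); positivity
  have hZ0 : 0 ≤ B * CM * (Zl (d + 1) δ * Zl (d + 1) δ) := (abs_nonneg _).trans hZ
  rw [abs_mul]
  calc |∑' x₂, ∑ κ₂, A' ((N : ℤ) • w) x₂ a' (Sum.inl κ₂) * gaugeWt N y κ₂ x₂| * |∑' xz : Site (d + 1) × Site (d + 1), ω xz * M ρ w xz.1 xz.2 a b|
      ≤ (((d + 1 : ℕ) * CA * Zl (d + 1) (δ / 2) * Real.exp ((δ / 2) * (((d : ℝ) + 1) * N + 1))) *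
          Real.exp (-(δ / 2) * ((N : ℝ) * l1 (y - y'))) * Real.exp (-δ * l1 ((N : ℤ) • w - (N : ℤ) • y'))) * (B * CM * (Zl (d + 1) δ * Zl (d + 1) δ)) :=
        mul_le_mul hw hZ (abs_nonneg _) ((abs_nonneg _).trans hw)
    _ = ((d + 1 : ℕ) * CA * Zl (d + 1) (δ / 2) * Real.exp ((δ / 2) * (((d : ℝ) + 1) * N + 1))) * (B * CM * (Zl (d + 1) δ * Zl (d + 1) δ))
          * Real.exp (-(δ / 2) * ((N : ℝ) * l1 (y - y'))) * Real.exp (-δ * l1 ((N : ℤ) • w - (N : ℤ) • y')) := by ring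
    _ ≤ _ := mul_le_mul_of_nonneg_left hexp (by positivity)

/-- NOT IN PRINT; OUR BOOKKEEPING.  **THE (γ) ω-CHARGE PROFILE IS EXPONENTIALLY LOCALISED AT ITS LABEL** — the `hZb` socket of
`SlotMomentParity.tsum_slotMoment_eq_zero_of_slotInv ∕ moments_of_slotInv` VERBATIM (`|Z e| ≤ B′·e^{−δ′‖e − y‖₁}` with `δ′ = δ∕2`): in the SETTING of the header, for EVERY
slot `y′`, `|Q_ω(y′)| ≤ B_γ·e^{−(δ∕2)‖y′ − y‖₁}`, `B_γ = (d+1)·K₁·(B·(Cs + CM)·Zl(δ)²)·Zl(δ)`, `K₁ = (d+1)·CA·Zl(δ∕2)·e^{(δ∕2)((d+1)N+1)}` (per read weight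
`GaugeReadChargeDipole.abs_read_gaugeWt_le`, per ω-charge `abs_tsum_prod_le_of_biLoc` at the absorbed table, `Σ'_u e^{−δ‖u − c‖₁} = Zl δ`, and `e^{−(δ∕2)N‖y−y′‖₁} ≤ e^{−(δ∕2)‖y′−y‖₁}`).
No estimate uniform in the level is claimed (`K₁` is `N`-dependent by design). -/
theorem abs_weightedGaugeCharge_le {N : ℕ} (hN : 1 ≤ N) {A : Fin (d + 1) → Site (d + 1) → MKer (d + 1) (Fib d)} {CA δ : ℝ}
    (hA : VertexFamily A N CA δ) (hδ : 0 < δ)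
    {S : Fin (d + 1) → Site (d + 1) → MKer (d + 1) (Fib d)} {Cs : ℝ} (hS : LocStencil S Cs δ)
    {M : Fin (d + 1) → Site (d + 1) → MKer (d + 1) (Fib d)} {CM : ℝ} (hM : VertexFamily M N CM δ)
    (y : Site (d + 1)) (ν : Fin (d + 1)) (a b : Fib d) {ω : Site (d + 1) × Site (d + 1) → ℝ} {B : ℝ} (hω : ∀ xz, |ω xz| ≤ B) (y' : Site (d + 1)) :
    |∑ κ, ∑' u, (∑' x₂, ∑ κ₂, A ν y' u x₂ (Sum.inl κ) (Sum.inl κ₂) * gaugeWt N y κ₂ x₂) *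
          ∑' xz : Site (d + 1) × Site (d + 1), ω xz * S κ u xz.1 xz.2 a b
        + ∑ ρ, ∑' w, (∑' x₂, ∑ κ₂, A ν y' ((N : ℤ) • w) x₂ (Sum.inr ρ) (Sum.inl κ₂) * gaugeWt N y κ₂ x₂) *
          ∑' xz : Site (d + 1) × Site (d + 1), ω xz * M ρ w xz.1 xz.2 a b|
      ≤ ((d + 1 : ℕ) * ((d + 1 : ℕ) * CA * Zl (d + 1) (δ / 2) * Real.exp ((δ / 2) * (((d : ℝ) + 1) * N + 1)))
            * (B * (Cs + CM) * (Zl (d + 1) δ * Zl (d + 1) δ)) * Zl (d + 1) δ) * Real.exp (-(δ / 2) * l1 (y' - y)) := by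
  set K₁ : ℝ := (d + 1 : ℕ) * CA * Zl (d + 1) (δ / 2) * Real.exp ((δ / 2) * (((d : ℝ) + 1) * N + 1)) with hK₁
  set E : ℝ := Real.exp (-(δ / 2) * ((N : ℝ) * l1 (y - y'))) with hE
  have hK0 : 0 ≤ K₁ := by have hC : 0 ≤ CA := (hA ν y').nonneg a; rw [hK₁]; have := Zl_nonneg (D := d + 1) (half_pos hδ); positivity
  have hB0 : 0 ≤ B := (abs_nonneg _).trans (hω (0, 0)); have hCs0 : 0 ≤ Cs := (hS ν 0).nonneg a
  have hCM0 : 0 ≤ CM := (hM ν 0).nonneg a; have hZl0 : 0 ≤ Zl (d + 1) δ := Zl_nonneg hδ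
  -- the two Gaussians summed over their stencil index
  have hGf : HasSum (fun u : Site (d + 1) => Real.exp (-δ * l1 (u - (N : ℤ) • y'))) (Zl (d + 1) δ) := by
    rw [← tsum_exp_shift' ((N : ℤ) • y')]; exact (summable_exp_shift' hδ _).hasSum
  have hGc : HasSum (fun w : Site (d + 1) => Real.exp (-δ * l1 (w - y'))) (Zl (d + 1) δ) := by
    rw [← tsum_exp_shift' y']; exact (summable_exp_shift' hδ _).hasSum
  -- fine part, one `κ`
  have hF : ∀ κ : Fin (d + 1), |∑' u, (∑' x₂, ∑ κ₂, A ν y' u x₂ (Sum.inl κ) (Sum.inl κ₂) * gaugeWt N y κ₂ x₂) *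
      ∑' xz : Site (d + 1) × Site (d + 1), ω xz * S κ u xz.1 xz.2 a b| ≤ K₁ * (B * Cs * (Zl (d + 1) δ * Zl (d + 1) δ)) * E * Zl (d + 1) δ := by
    intro κ
    have h := tsum_of_norm_bounded (hGf.mul_left (K₁ * (B * Cs * (Zl (d + 1) δ * Zl (d + 1) δ)) * E))
      (fun u => by rw [Real.norm_eq_abs]; exact abs_fineTerm_le hN (hA ν y') hδ hS hω κ u (Sum.inl κ) a b)
    rw [Real.norm_eq_abs] at h
    exact h
  -- coarse part, one `ρ`
  have hC : ∀ ρ : Fin (d + 1), |∑' w, (∑' x₂, ∑ κ₂, A ν y' ((N : ℤ) • w) x₂ (Sum.inr ρ) (Sum.inl κ₂) * gaugeWt N y κ₂ x₂) *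
      ∑' xz : Site (d + 1) × Site (d + 1), ω xz * M ρ w xz.1 xz.2 a b| ≤ K₁ * (B * CM * (Zl (d + 1) δ * Zl (d + 1) δ)) * E * Zl (d + 1) δ := by
    intro ρ
    have h := tsum_of_norm_bounded (hGc.mul_left (K₁ * (B * CM * (Zl (d + 1) δ * Zl (d + 1) δ)) * E))
      (fun w => by rw [Real.norm_eq_abs]; exact abs_coarseTerm_le hN (hA ν y') hδ hM hω ρ w (Sum.inr ρ) a b)
    rw [Real.norm_eq_abs] at h
    exact h
  have hEle : E ≤ Real.exp (-(δ / 2) * l1 (y' - y)) := exp_slot_le hN hδ.le y y'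
  have hsumF := (Finset.abs_sum_le_sum_abs _ _).trans (Finset.sum_le_sum fun κ (_ : κ ∈ (Finset.univ : Finset (Fin (d + 1)))) => hF κ)
  have hsumC := (Finset.abs_sum_le_sum_abs _ _).trans (Finset.sum_le_sum fun ρ (_ : ρ ∈ (Finset.univ : Finset (Fin (d + 1)))) => hC ρ)
  rw [Finset.sum_const, Finset.card_univ, Fintype.card_fin, nsmul_eq_mul] at hsumF hsumC
  have hnn : 0 ≤ ((d + 1 : ℕ) : ℝ) * (K₁ * (B * (Cs + CM) * (Zl (d + 1) δ * Zl (d + 1) δ)) * Zl (d + 1) δ) := by positivity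
  calc _ ≤ ((d + 1 : ℕ) : ℝ) * (K₁ * (B * Cs * (Zl (d + 1) δ * Zl (d + 1) δ)) * E * Zl (d + 1) δ)
          + ((d + 1 : ℕ) : ℝ) * (K₁ * (B * CM * (Zl (d + 1) δ * Zl (d + 1) δ)) * E * Zl (d + 1) δ) := (abs_add_le _ _).trans (add_le_add hsumF hsumC)
    _ = ((d + 1 : ℕ) : ℝ) * (K₁ * (B * (Cs + CM) * (Zl (d + 1) δ * Zl (d + 1) δ)) * Zl (d + 1) δ) * E := by ring
    _ ≤ ((d + 1 : ℕ) : ℝ) * (K₁ * (B * (Cs + CM) * (Zl (d + 1) δ * Zl (d + 1) δ)) * Zl (d + 1) δ) * Real.exp (-(δ / 2) * l1 (y' - y)) :=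
        mul_le_mul_of_nonneg_left hEle hnn
    _ = _ := by rw [hK₁]; ring

/-! ## §4 The mass: the (γ) ω-charge profile summed over the slots (the `hm` socket) -/

/-- [folklore] Fubini step: a summable family on `Site × Site`, summed fibrewise in its second variable, is `HasSum` in its first, with value the exchanged iterated sum. -/
theorem hasSum_tsum_of_summable_prod {F : Site (d + 1) → Site (d + 1) → ℝ} (hF : Summable (Function.uncurry F)) :
    HasSum (fun y' => ∑' u, F y' u) (∑' u, ∑' y', F y' u) := by
  rw [hF.tsum_comm]
  exact hF.prod.hasSum

/-- [folklore] **THE FINE MASS FAMILY IS ABSOLUTELY SUMMABLE** on (slot, stencil index): `(y′, u) ↦ w_κ(y′,u)·Z_ω(S κ u)` (majorant of §3, `summable_shifted_majorant` at rate `δ∕2`). -/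
theorem summable_weightedGaugeCharge_fine {N : ℕ} (hN : 1 ≤ N) {A' : Site (d + 1) → MKer (d + 1) (Fib d)} {CA δ : ℝ}
    (hA : ∀ y', BiLoc (A' y') ((N : ℤ) • y') ((N : ℤ) • y') CA δ) (hδ : 0 < δ)
    {S : Fin (d + 1) → Site (d + 1) → MKer (d + 1) (Fib d)} {Cs : ℝ} (hS : LocStencil S Cs δ)
    {ω : Site (d + 1) × Site (d + 1) → ℝ} {B : ℝ} (hω : ∀ xz, |ω xz| ≤ B) (y : Site (d + 1)) (κ : Fin (d + 1)) (a' a b : Fib d) :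
    Summable fun yu : Site (d + 1) × Site (d + 1) =>
      (∑' x₂, ∑ κ₂, A' yu.1 yu.2 x₂ a' (Sum.inl κ₂) * gaugeWt N y κ₂ x₂) * ∑' xz : Site (d + 1) × Site (d + 1), ω xz * S κ yu.2 xz.1 xz.2 a b := by
  set K₁ : ℝ := (d + 1 : ℕ) * CA * Zl (d + 1) (δ / 2) * Real.exp ((δ / 2) * (((d : ℝ) + 1) * N + 1)) with hK₁
  have hmaj := summable_shifted_majorant (d := d) (c := δ / 2) (half_pos hδ) hδ (K₁ * (B * Cs * (Zl (d + 1) δ * Zl (d + 1) δ))) y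
    (fun y' => (N : ℤ) • y')
  refine Summable.of_norm_bounded hmaj (fun yu => ?_)
  rw [Real.norm_eq_abs]
  have h := abs_fineTerm_le hN (y := y) (hA yu.1) hδ hS hω κ yu.2 a' a b
  have hK0 : 0 ≤ K₁ * (B * Cs * (Zl (d + 1) δ * Zl (d + 1) δ)) := by
    have hC : 0 ≤ CA := (hA yu.1).nonneg a'
    have hB : 0 ≤ B := (abs_nonneg _).trans (hω (0, 0))
    have hCs : 0 ≤ Cs := (hS κ yu.2).nonneg a
    have hZ := Zl_nonneg (D := d + 1) hδ; have hZ2 := Zl_nonneg (D := d + 1) (half_pos hδ); rw [hK₁]; positivity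
  calc _ ≤ K₁ * (B * Cs * (Zl (d + 1) δ * Zl (d + 1) δ)) * Real.exp (-(δ / 2) * ((N : ℝ) * l1 (y - yu.1))) *
        Real.exp (-δ * l1 (yu.2 - (N : ℤ) • yu.1)) := h
    _ ≤ K₁ * (B * Cs * (Zl (d + 1) δ * Zl (d + 1) δ)) * Real.exp (-(δ / 2) * l1 (yu.1 - y)) * Real.exp (-δ * l1 (yu.2 - (N : ℤ) • yu.1)) :=
        mul_le_mul_of_nonneg_right (mul_le_mul_of_nonneg_left (exp_slot_le hN hδ.le y yu.1) hK0) (Real.exp_pos _).le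
    _ = _ := by ring

/-- [folklore] **THE COARSE MASS FAMILY IS ABSOLUTELY SUMMABLE** on (slot, vertex index): `(y′, w) ↦ w′_ρ(y′,w)·Z_ω(M ρ w)`. -/
theorem summable_weightedGaugeCharge_coarse {N : ℕ} (hN : 1 ≤ N) {A' : Site (d + 1) → MKer (d + 1) (Fib d)} {CA δ : ℝ}
    (hA : ∀ y', BiLoc (A' y') ((N : ℤ) • y') ((N : ℤ) • y') CA δ) (hδ : 0 < δ)
    {M : Fin (d + 1) → Site (d + 1) → MKer (d + 1) (Fib d)} {CM : ℝ} (hM : VertexFamily M N CM δ)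
    {ω : Site (d + 1) × Site (d + 1) → ℝ} {B : ℝ} (hω : ∀ xz, |ω xz| ≤ B) (y : Site (d + 1)) (ρ : Fin (d + 1)) (a' a b : Fib d) :
    Summable fun yw : Site (d + 1) × Site (d + 1) =>
      (∑' x₂, ∑ κ₂, A' yw.1 ((N : ℤ) • yw.2) x₂ a' (Sum.inl κ₂) * gaugeWt N y κ₂ x₂) *
        ∑' xz : Site (d + 1) × Site (d + 1), ω xz * M ρ yw.2 xz.1 xz.2 a b := by
  set K₁ : ℝ := (d + 1 : ℕ) * CA * Zl (d + 1) (δ / 2) * Real.exp ((δ / 2) * (((d : ℝ) + 1) * N + 1)) with hK₁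
  have hmaj := summable_shifted_majorant (d := d) (c := δ / 2) (half_pos hδ) hδ (K₁ * (B * CM * (Zl (d + 1) δ * Zl (d + 1) δ))) y
    (fun y' => y')
  refine Summable.of_norm_bounded hmaj (fun yw => ?_)
  rw [Real.norm_eq_abs]
  have h := abs_coarseTerm_le hN (y := y) (hA yw.1) hδ hM hω ρ yw.2 a' a b
  have hK0 : 0 ≤ K₁ * (B * CM * (Zl (d + 1) δ * Zl (d + 1) δ)) := by
    have hC : 0 ≤ CA := (hA yw.1).nonneg a'
    have hB : 0 ≤ B := (abs_nonneg _).trans (hω (0, 0))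
    have hCM : 0 ≤ CM := (hM ρ yw.2).nonneg a
    have hZ := Zl_nonneg (D := d + 1) hδ; have hZ2 := Zl_nonneg (D := d + 1) (half_pos hδ); rw [hK₁]; positivity
  calc _ ≤ K₁ * (B * CM * (Zl (d + 1) δ * Zl (d + 1) δ)) * Real.exp (-(δ / 2) * ((N : ℝ) * l1 (y - yw.1))) * Real.exp (-δ * l1 (yw.2 - yw.1)) := h
    _ ≤ K₁ * (B * CM * (Zl (d + 1) δ * Zl (d + 1) δ)) * Real.exp (-(δ / 2) * l1 (yw.1 - y)) * Real.exp (-δ * l1 (yw.2 - yw.1)) :=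
        mul_le_mul_of_nonneg_right (mul_le_mul_of_nonneg_left (exp_slot_le hN hδ.le y yw.1) hK0) (Real.exp_pos _).le
    _ = _ := by ring

/-- NOT IN PRINT; OUR BOOKKEEPING.  **THE MASS OF THE (γ) ω-CHARGE PROFILE AS A `HasSum`** — the `hm` socket of `SlotMomentParity.hasSum_moments_sum` for the (γ) piece: in
the SETTING of the header, `HasSum (y′ ↦ Q_ω(y′)) (Σ_κ Σ'_u (Σ'_{y′} w_κ(y′,u))·Z_ω(S κ u) + Σ_ρ Σ'_w (Σ'_{y′} w′_ρ(y′,w))·Z_ω(M ρ w))` — the letters' ω-charges weighted by the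
SLOT-SUMMED read weights (one Fubini per stencil index on the families of this §).  Whether this value VANISHES is (M0)_γ — it needs the joint block covariance of `A ν ·` and of the
tables' ω-charges and is NOT claimed here (R14: (M0)_j for the TOTAL profile is W-Z0, displayed). -/
theorem hasSum_weightedGaugeCharge_mass {N : ℕ} (hN : 1 ≤ N) {A : Fin (d + 1) → Site (d + 1) → MKer (d + 1) (Fib d)} {CA δ : ℝ}
    (hA : VertexFamily A N CA δ) (hδ : 0 < δ)
    {S : Fin (d + 1) → Site (d + 1) → MKer (d + 1) (Fib d)} {Cs : ℝ} (hS : LocStencil S Cs δ)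
    {M : Fin (d + 1) → Site (d + 1) → MKer (d + 1) (Fib d)} {CM : ℝ} (hM : VertexFamily M N CM δ)
    (y : Site (d + 1)) (ν : Fin (d + 1)) (a b : Fib d) {ω : Site (d + 1) × Site (d + 1) → ℝ} {B : ℝ} (hω : ∀ xz, |ω xz| ≤ B) :
    HasSum (fun y' : Site (d + 1) =>
        ∑ κ, ∑' u, (∑' x₂, ∑ κ₂, A ν y' u x₂ (Sum.inl κ) (Sum.inl κ₂) * gaugeWt N y κ₂ x₂) *
              ∑' xz : Site (d + 1) × Site (d + 1), ω xz * S κ u xz.1 xz.2 a b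
          + ∑ ρ, ∑' w, (∑' x₂, ∑ κ₂, A ν y' ((N : ℤ) • w) x₂ (Sum.inr ρ) (Sum.inl κ₂) * gaugeWt N y κ₂ x₂) *
              ∑' xz : Site (d + 1) × Site (d + 1), ω xz * M ρ w xz.1 xz.2 a b)
      (∑ κ, ∑' u, (∑' y' : Site (d + 1), ∑' x₂, ∑ κ₂, A ν y' u x₂ (Sum.inl κ) (Sum.inl κ₂) * gaugeWt N y κ₂ x₂) *
            ∑' xz : Site (d + 1) × Site (d + 1), ω xz * S κ u xz.1 xz.2 a b
        + ∑ ρ, ∑' w, (∑' y' : Site (d + 1), ∑' x₂, ∑ κ₂, A ν y' ((N : ℤ) • w) x₂ (Sum.inr ρ) (Sum.inl κ₂) * gaugeWt N y κ₂ x₂) *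
            ∑' xz : Site (d + 1) × Site (d + 1), ω xz * M ρ w xz.1 xz.2 a b) := by
  -- fine part, one `κ` at a time: Fubini on the summable family of this §, then `tsum_mul_right` in the value
  have hF : ∀ κ : Fin (d + 1), HasSum (fun y' : Site (d + 1) => ∑' u, (∑' x₂, ∑ κ₂, A ν y' u x₂ (Sum.inl κ) (Sum.inl κ₂) * gaugeWt N y κ₂ x₂) *
        ∑' xz : Site (d + 1) × Site (d + 1), ω xz * S κ u xz.1 xz.2 a b)
      (∑' u, (∑' y' : Site (d + 1), ∑' x₂, ∑ κ₂, A ν y' u x₂ (Sum.inl κ) (Sum.inl κ₂) * gaugeWt N y κ₂ x₂) *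
        ∑' xz : Site (d + 1) × Site (d + 1), ω xz * S κ u xz.1 xz.2 a b) := by
    intro κ
    have h := hasSum_tsum_of_summable_prod (F := fun y' u => (∑' x₂, ∑ κ₂, A ν y' u x₂ (Sum.inl κ) (Sum.inl κ₂) * gaugeWt N y κ₂ x₂) *
        ∑' xz : Site (d + 1) × Site (d + 1), ω xz * S κ u xz.1 xz.2 a b)
      (summable_weightedGaugeCharge_fine hN (A' := A ν) (fun y' => hA ν y') hδ hS hω y κ (Sum.inl κ) a b)
    simp only [tsum_mul_right] at h
    exact h
  -- coarse part, one `ρ` at a time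
  have hC : ∀ ρ : Fin (d + 1), HasSum (fun y' : Site (d + 1) => ∑' w, (∑' x₂, ∑ κ₂, A ν y' ((N : ℤ) • w) x₂ (Sum.inr ρ) (Sum.inl κ₂) * gaugeWt N y κ₂ x₂) *
        ∑' xz : Site (d + 1) × Site (d + 1), ω xz * M ρ w xz.1 xz.2 a b)
      (∑' w, (∑' y' : Site (d + 1), ∑' x₂, ∑ κ₂, A ν y' ((N : ℤ) • w) x₂ (Sum.inr ρ) (Sum.inl κ₂) * gaugeWt N y κ₂ x₂) *
        ∑' xz : Site (d + 1) × Site (d + 1), ω xz * M ρ w xz.1 xz.2 a b) := by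
    intro ρ
    have h := hasSum_tsum_of_summable_prod (F := fun y' w => (∑' x₂, ∑ κ₂, A ν y' ((N : ℤ) • w) x₂ (Sum.inr ρ) (Sum.inl κ₂) * gaugeWt N y κ₂ x₂) *
        ∑' xz : Site (d + 1) × Site (d + 1), ω xz * M ρ w xz.1 xz.2 a b)
      (summable_weightedGaugeCharge_coarse hN (A' := A ν) (fun y' => hA ν y') hδ hM hω y ρ (Sum.inr ρ) a b)
    simp only [tsum_mul_right] at h
    exact h
  exact (hasSum_sum fun κ (_ : κ ∈ (Finset.univ : Finset (Fin (d + 1)))) => hF κ).add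
    (hasSum_sum fun ρ (_ : ρ ∈ (Finset.univ : Finset (Fin (d + 1)))) => hC ρ)

/-! ## §5 The plain currency `ω ≡ 1`: envelope and mass of the INTENT 3 ∕ 4 profile verbatim -/

/-- NOT IN PRINT; OUR BOOKKEEPING.  **THE PLAIN (γ) SLOT-CHARGE PROFILE IS EXPONENTIALLY LOCALISED AT ITS LABEL** (§3 at `ω ≡ 1`): for the profile `y′ ↦ Q(y′)` of
`GaugeReadChargeDipole.hasSum_slotMoment_gaugeCharge` (plain pair charges `Z(K) = Σ'_{(x,z)} K x z a b`), `|Q(y′)| ≤ B_γ¹·e^{−(δ∕2)‖y′ − y‖₁}` with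
`B_γ¹ = (d+1)·K₁·((Cs + CM)·Zl(δ)²)·Zl(δ)` — the `hZb` socket for the plain (γ) profile. -/
theorem abs_gaugeCharge_le {N : ℕ} (hN : 1 ≤ N) {A : Fin (d + 1) → Site (d + 1) → MKer (d + 1) (Fib d)} {CA δ : ℝ}
    (hA : VertexFamily A N CA δ) (hδ : 0 < δ)
    {S : Fin (d + 1) → Site (d + 1) → MKer (d + 1) (Fib d)} {Cs : ℝ} (hS : LocStencil S Cs δ)
    {M : Fin (d + 1) → Site (d + 1) → MKer (d + 1) (Fib d)} {CM : ℝ} (hM : VertexFamily M N CM δ)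
    (y : Site (d + 1)) (ν : Fin (d + 1)) (a b : Fib d) (y' : Site (d + 1)) :
    |∑ κ, ∑' u, (∑' x₂, ∑ κ₂, A ν y' u x₂ (Sum.inl κ) (Sum.inl κ₂) * gaugeWt N y κ₂ x₂) *
          ∑' xz : Site (d + 1) × Site (d + 1), S κ u xz.1 xz.2 a b
        + ∑ ρ, ∑' w, (∑' x₂, ∑ κ₂, A ν y' ((N : ℤ) • w) x₂ (Sum.inr ρ) (Sum.inl κ₂) * gaugeWt N y κ₂ x₂) *
          ∑' xz : Site (d + 1) × Site (d + 1), M ρ w xz.1 xz.2 a b|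
      ≤ ((d + 1 : ℕ) * ((d + 1 : ℕ) * CA * Zl (d + 1) (δ / 2) * Real.exp ((δ / 2) * (((d : ℝ) + 1) * N + 1)))
            * ((1 : ℝ) * (Cs + CM) * (Zl (d + 1) δ * Zl (d + 1) δ)) * Zl (d + 1) δ) * Real.exp (-(δ / 2) * l1 (y' - y)) := by
  have h := abs_weightedGaugeCharge_le hN hA hδ hS hM y ν a b (ω := fun _ => (1 : ℝ)) (B := 1) (fun _ => by rw [abs_one]) y'
  simp only [one_mul] at h ⊢
  exact h

/-- NOT IN PRINT; OUR BOOKKEEPING.  **THE MASS OF THE PLAIN (γ) SLOT-CHARGE PROFILE AS A `HasSum`** (§4 at `ω ≡ 1`): `HasSum (y′ ↦ Q(y′)) (Σ_κ Σ'_u (Σ'_{y′} w_κ(y′,u))·Z(S κ u)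
+ Σ_ρ Σ'_w (Σ'_{y′} w′_ρ(y′,w))·Z(M ρ w))` — the `hm` socket for the plain (γ) profile of INTENT 4.  (M0)_γ NOT claimed. -/
theorem hasSum_gaugeCharge_mass {N : ℕ} (hN : 1 ≤ N) {A : Fin (d + 1) → Site (d + 1) → MKer (d + 1) (Fib d)} {CA δ : ℝ}
    (hA : VertexFamily A N CA δ) (hδ : 0 < δ)
    {S : Fin (d + 1) → Site (d + 1) → MKer (d + 1) (Fib d)} {Cs : ℝ} (hS : LocStencil S Cs δ)
    {M : Fin (d + 1) → Site (d + 1) → MKer (d + 1) (Fib d)} {CM : ℝ} (hM : VertexFamily M N CM δ)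
    (y : Site (d + 1)) (ν : Fin (d + 1)) (a b : Fib d) :
    HasSum (fun y' : Site (d + 1) =>
        ∑ κ, ∑' u, (∑' x₂, ∑ κ₂, A ν y' u x₂ (Sum.inl κ) (Sum.inl κ₂) * gaugeWt N y κ₂ x₂) *
              ∑' xz : Site (d + 1) × Site (d + 1), S κ u xz.1 xz.2 a b
          + ∑ ρ, ∑' w, (∑' x₂, ∑ κ₂, A ν y' ((N : ℤ) • w) x₂ (Sum.inr ρ) (Sum.inl κ₂) * gaugeWt N y κ₂ x₂) *
              ∑' xz : Site (d + 1) × Site (d + 1), M ρ w xz.1 xz.2 a b)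
      (∑ κ, ∑' u, (∑' y' : Site (d + 1), ∑' x₂, ∑ κ₂, A ν y' u x₂ (Sum.inl κ) (Sum.inl κ₂) * gaugeWt N y κ₂ x₂) *
            ∑' xz : Site (d + 1) × Site (d + 1), S κ u xz.1 xz.2 a b
        + ∑ ρ, ∑' w, (∑' y' : Site (d + 1), ∑' x₂, ∑ κ₂, A ν y' ((N : ℤ) • w) x₂ (Sum.inr ρ) (Sum.inl κ₂) * gaugeWt N y κ₂ x₂) *
            ∑' xz : Site (d + 1) × Site (d + 1), M ρ w xz.1 xz.2 a b) := by
  have h := hasSum_weightedGaugeCharge_mass hN hA hδ hS hM y ν a b (ω := fun _ => (1 : ℝ)) (B := 1) (fun _ => by rw [abs_one])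
  simp only [one_mul] at h
  exact h

end Summit.QuantumFields.BalabanUV.Beta.GAN24.GaugeReadChargeProfile

end
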